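import Literature.NumberTheory.EllipticCurves.FormalGroupLawAxiomsUniversalProofs
import Literature.NumberTheory.EllipticCurves.FormalGroupMultiplication
import Literature.NumberTheory.EllipticCurves.FormalGroupHasseInvariantProofs
import HarnessLib

/-!
# The multiplication maps `[n]` of the formal group over EVERY commutative ring:
# `[m+n] = F([m],[n])`, `[m]∘[n] = [mn]`, `ω₀([n])[n]' = nω₀`, `[p] = p·f + g(tᵖ)`, and
# `g'(0) = [tᵖ][p] ≡ w_{p-1} ≡ A_p (mod p)` (Silverman AEC IV.2.3, IV.4.3–4.4; Katz–Mazur 12.4.2)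

Trunk T-NT-EC (Literature/NumberTheory/EllipticCurves). `FormalGroupMultiplication.lean` defines
`formalMul W n = [n](t)` over any ring but proves its properties only for `p`-integral equations
over `ℚ_p` (by evaluation at points of `E₁(ℚ_p)` and `p`-adic norms). With the ring-general
formal-group axioms of `FormalGroupLawAxiomsUniversalProofs.lean` (`universalInt`, transfer
`ℚ[aᵢ] ⇒ ℤ[aᵢ] ⇒ R`) everything becomes available for every Weierstrass curve over every
commutative ring — in particular over Blakestad–Grant's `R̂` and over `𝔽_p[A₄, A₆]`:

* over a `ℚ`-algebra domain: `formalLog_subst_formalMul_rat` (`log ∘ [n] = n·log`, from the tree's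
  unconditional `formalLog_subst_formalGroupLaw`), `eq_of_formalLog_subst_eq`, and the `_rat`
  versions of the identities below;
* over every ring: **`formalMul_add'`** (`[m+n] = F([m],[n])`), **`formalMul_mul_subst'`**
  (`[m]∘[n] = [mn]`), `formalMul_subst_comm'`, `formalMul_succ''`,
  **`formalInvDiff_subst_formalMul_mul_derivative'`** (`ω₀([n](t))·[n]'(t) = n·ω₀(t)` for the
  integral invariant differential `ω₀ = formalInvDiff`, AEC IV.4.3), `coeff_one_formalMul'`
  (`[n] = nt + ⋯`);
* `(p)` is a prime ideal of `ℤ[aᵢ]` (`span_natCast_mvPolynomial_isPrime`), and AEC IV.4.4 for the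
  universal equation: `natCast_dvd_coeff_formalMul_universalInt` (`p ∣ [tᵏ][p]` in `ℤ[aᵢ]` for
  `p ∤ k`, from `[p]' ∈ pℤ[aᵢ]⟦t⟧`); whence over every ring the decomposition
  **`formalMul_prime_eq_add_expand : [p](t) = p·f(t) + g(tᵖ)`** with
  `f = formalMulPPart W p`, `g = formalMulFrobPart W p ∈ R⟦t⟧` (`map_formalMulPPart`,
  `map_formalMulFrobPart`: both commute with base change), `coeff_formalMul_prime_mem_span`
  (`[p] ≡ g(tᵖ) (mod p)`), `formalMul_prime_eq_expand_of_charP` (`[p] = g(tᵖ)` in char. `p`);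
* **`coeff_prime_formalMul_sub_coeff_formalInvDiff_mem_span`,
  `coeff_prime_formalMul_sub_hasseCoeff_mem_span`** — over every ring,
  `[tᵖ][p] ≡ w_{p-1} ≡ A_p (mod p)` (`ω₀ = Σwₙtⁿdt`, `A_p = hasseCoeff`): modulo `p` the
  multiplication by `p` is `V(tᵖ)` with `V(s) = A_p s + O(s²)`, the Verschiebung, whose linear
  term is the Hasse invariant (Katz–Mazur 12.4.2). Proof: cancel `p` in `ω₀([p])[p]' = pω₀` using
  `[p]' = p(f' + t^{p-1}g'(tᵖ))` over `ℤ[aᵢ]⟦t⟧`, reduce modulo `p` where `ω₀([p]) = (ω₀∘g)(tᵖ)`,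
  and read off the coefficient of `t^{p-1}`; then `w_{p-1} = A_p` in characteristic `p` (tree,
  `coeff_formalInvDiff_prime_sub_one`).

These are the `ℚ_p`-free forms of `FormalGroupMultiplication`'s `formalMul_add`,
`formalMul_mul_subst`, `formalOmega_subst_formalMul_mul_derivative`, `coeff_one_formalMul`,
`formalMul_prime_eq_add_subst_X_pow`, `norm_coeff_formalMul_prime_le`,
`norm_coeff_prime_formalMul_sub_hasseCoeff_lt_one` (whose names the primed/new names avoid).

## Sources

* J. H. Silverman, *The Arithmetic of Elliptic Curves*, 2nd ed. (2009): IV.2.3 (`[m]`),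
  IV.4.3 (`ω(f(T))f'(T) = f'(0)ω(T)`), IV.4.4 (`[p](T) = pf(T) + g(Tᵖ)`), IV.5.2, IV.7.2.
  [SilvermanAEC2009]
* N. M. Katz, B. Mazur, *Arithmetic Moduli of Elliptic Curves* (1985), 12.4.2 (the Hasse invariant
  as the linear term of the Verschiebung on the formal group). [folklore]
* C. Blakestad, D. Grant, J. Number Theory 249 (2023), Prop. 3(b) and Remark (`H₁ = w_{p-1} ≡ H`),
  for the use over `R̂`. [BlakestadGrant2023]

## Design notes

Two definitions with bodies: `formalMulFrobPart W p` (`g`, by its coefficients) and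
`formalMulPPart W p` (`f`, the base change of the universal `formalMulPPartUniv p`, itself defined
by choice of the quotients `[tᵏ][p]/p ∈ ℤ[aᵢ]`); no named facts. All transfers go through
`universalInt.map W.universalEval = W`.
-/

noncomputable section

open PowerSeries Literature.NumberTheory.EllipticCurves

namespace WeierstrassCurve

/-! ### Over a `ℚ`-algebra domain: `log ∘ [n] = n·log` and its consequences -/

section RatDomainMul

variable {A : Type*} [CommRing A] [Algebra ℚ A] [IsDomain A] (V : WeierstrassCurve A)

/-- `log_W(F(g, h)) = log_W g + log_W h` for series `g, h` without constant term.
[Silverman AEC IV.5.2] [folklore] -/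
theorem formalLog_subst_subst_pair_formalGroupLaw {σ : Type*} {g h : MvPowerSeries σ A}
    (hg : MvPowerSeries.constantCoeff g = 0) (hh : MvPowerSeries.constantCoeff h = 0) :
    V.formalLog.subst (MvPowerSeries.subst ![g, h] V.formalGroupLaw) =
      V.formalLog.subst g + V.formalLog.subst h := by
  have hs := hasSubst_pair hg hh
  rw [← mvSubst_powerSeries_subst V.hasSubst_formalGroupLaw hs, V.formalLog_subst_formalGroupLaw,
    MvPowerSeries.subst_add hs, mvSubst_powerSeries_subst (PowerSeries.HasSubst.X 0) hs,
    mvSubst_powerSeries_subst (PowerSeries.HasSubst.X 1) hs, MvPowerSeries.subst_X hs,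
    MvPowerSeries.subst_X hs]
  simp only [Matrix.cons_val_zero, Matrix.cons_val_one]

/-- **`log_W([n](t)) = n · log_W(t)`** over a `ℚ`-algebra domain: `log_W` linearises the
multiplication maps (induction on `n`, `[n+1] = F([n], t)`). [Silverman AEC IV.5.2 with IV.2.3]
[cite: SilvermanAEC2009, IV.5.2] -/
theorem formalLog_subst_formalMul_rat (n : ℕ) :
    V.formalLog.subst (V.formalMul n) = n • V.formalLog := by
  induction n with
  | zero =>
    rw [formalMul_zero, zero_nsmul]
    exact PowerSeries.subst_zero_of_constantCoeff_zero V.constantCoeff_formalLog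
  | succ n ih =>
    rw [formalMul_succ, V.formalLog_subst_subst_pair_formalGroupLaw (V.constantCoeff_formalMul n)
      PowerSeries.constantCoeff_X, ih, formalLog_subst_X, succ_nsmul]

omit [IsDomain A] in
/-- **Series with the same formal logarithm are equal**: `log_W f = log_W g` with
`f(0) = g(0) = 0` implies `f = g` (apply `exp_W`). [Silverman AEC IV.5.5] [folklore] -/
theorem eq_of_formalLog_subst_eq {τ : Type*} {f g : MvPowerSeries τ A}
    (hf : MvPowerSeries.constantCoeff f = 0) (hg : MvPowerSeries.constantCoeff g = 0)
    (h : V.formalLog.subst f = V.formalLog.subst g) : f = g := by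
  have key : ∀ {u : MvPowerSeries τ A}, MvPowerSeries.constantCoeff u = 0 →
      V.formalExp.subst (V.formalLog.subst u) = u := fun {u} hu => by
    have hsu : PowerSeries.HasSubst u := PowerSeries.HasSubst.of_constantCoeff_zero hu
    have e := PowerSeries.subst_comp_subst_apply (hasSubst_formalLog V) hsu V.formalExp
    rw [formalExp_subst_formalLog, PowerSeries.subst_X hsu] at e
    exact e.symm
  rw [← key hf, ← key hg, h]

/-- **`[m + n](t) = F([m](t), [n](t))`** over a `ℚ`-algebra domain (both sides have logarithm
`(m + n)·log_W`). [Silverman AEC IV.2.3] [cite: SilvermanAEC2009, IV.2.3] -/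
theorem formalMul_add_rat (m n : ℕ) :
    V.formalMul (m + n) = MvPowerSeries.subst ![V.formalMul m, V.formalMul n] V.formalGroupLaw := by
  refine V.eq_of_formalLog_subst_eq (V.constantCoeff_formalMul _)
    (MvPowerSeries.constantCoeff_subst_eq_zero (hasSubst_pair (V.constantCoeff_formalMul m)
      (V.constantCoeff_formalMul n)) (fun k => by
        fin_cases k <;> exact V.constantCoeff_formalMul _) V.constantCoeff_formalGroupLaw) ?_
  rw [formalLog_subst_formalMul_rat, V.formalLog_subst_subst_pair_formalGroupLaw
    (V.constantCoeff_formalMul m) (V.constantCoeff_formalMul n), formalLog_subst_formalMul_rat,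
    formalLog_subst_formalMul_rat, add_nsmul]

/-- **`[m]([n](t)) = [mn](t)`** over a `ℚ`-algebra domain (both sides have logarithm
`mn·log_W`). [Silverman AEC IV.2.3] [cite: SilvermanAEC2009, IV.2.3] -/
theorem formalMul_mul_subst_rat (m n : ℕ) :
    (V.formalMul m).subst (V.formalMul n) = V.formalMul (m * n) := by
  have hn := V.hasSubst_formalMul n
  refine V.eq_of_formalLog_subst_eq
    (PowerSeries.constantCoeff_subst_eq_zero (V.constantCoeff_formalMul n) _
      (V.constantCoeff_formalMul m)) (V.constantCoeff_formalMul _) ?_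
  rw [← PowerSeries.subst_comp_subst_apply (V.hasSubst_formalMul m) hn, formalLog_subst_formalMul_rat,
    formalLog_subst_formalMul_rat, ← PowerSeries.coe_substAlgHom hn, map_nsmul,
    PowerSeries.coe_substAlgHom, formalLog_subst_formalMul_rat, mul_comm m n, mul_nsmul]

/-- **`ω([n](t)) · [n]'(t) = n · ω(t)`** over a `ℚ`-algebra domain (differentiate
`log_W ∘ [n] = n · log_W`). [Silverman AEC IV.4.3 (`ω(f(T)) f'(T) = f'(0) ω(T)`), IV.2.3]
[cite: SilvermanAEC2009, IV.4.3] -/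
theorem formalOmega_subst_formalMul_mul_derivative_rat (n : ℕ) :
    V.formalOmega.subst (V.formalMul n) * d⁄dX A (V.formalMul n) = n • V.formalOmega := by
  have h := congrArg (d⁄dX A) (V.formalLog_subst_formalMul_rat n)
  rwa [derivative_subst A (V.hasSubst_formalMul n), map_nsmul, V.derivative_formalLog] at h

/-- **`ω₀([n](t)) · [n]'(t) = n · ω₀(t)`** for the INTEGRAL invariant differential
`ω₀ = formalInvDiff = η⁻¹ ∈ R⟦t⟧` (over a `ℚ`-algebra `ω₀ = formalOmega`). [Silverman AEC IV.4.3]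
[cite: SilvermanAEC2009, IV.4.3] -/
theorem formalInvDiff_subst_formalMul_mul_derivative_rat (n : ℕ) :
    V.formalInvDiff.subst (V.formalMul n) * d⁄dX A (V.formalMul n) = n • V.formalInvDiff := by
  rw [formalInvDiff_eq_formalOmega]
  exact V.formalOmega_subst_formalMul_mul_derivative_rat n

end RatDomainMul

/-! ### Over every commutative ring -/

section AnyRingMul

variable {R : Type*} [CommRing R] (W : WeierstrassCurve R)


/-- `(f ∘ g)(0) = f(0)` when `g(0) = 0` (one variable). [folklore] -/
theorem constantCoeff_subst_eq_constantCoeff {f g : R⟦X⟧} (hg : PowerSeries.constantCoeff g = 0) :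
    PowerSeries.constantCoeff (f.subst g) = PowerSeries.constantCoeff f := by
  have hs : PowerSeries.HasSubst g := PowerSeries.HasSubst.of_constantCoeff_zero' hg
  obtain ⟨f₁, hf₁⟩ : PowerSeries.X ∣ f - PowerSeries.C (PowerSeries.constantCoeff f) :=
    PowerSeries.X_dvd_iff.mpr (by simp)
  have hf : f = PowerSeries.C (PowerSeries.constantCoeff f) + PowerSeries.X * f₁ := by
    rw [← hf₁]; ring
  conv_lhs => rw [hf]
  rw [← PowerSeries.coe_substAlgHom hs, map_add, map_mul, PowerSeries.coe_substAlgHom,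
    PowerSeries.subst_C, PowerSeries.subst_X hs, map_add, map_mul]
  change PowerSeries.constantCoeff (PowerSeries.C (PowerSeries.constantCoeff f)) +
    PowerSeries.constantCoeff g * _ = _
  rw [hg, zero_mul, add_zero, PowerSeries.constantCoeff_C]

/-- `PowerSeries.map` through a one-variable substitution (Mathlib's `PowerSeries.map_subst`, with
`PowerSeries.map` on both sides). [folklore] -/
theorem powerSeries_map_subst {S : Type*} [CommRing S] (φ : R →+* S) {f g : R⟦X⟧}
    (hg : PowerSeries.HasSubst g) :
    PowerSeries.map φ (f.subst g) = (PowerSeries.map φ f).subst (PowerSeries.map φ g) := by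
  change MvPowerSeries.map φ (f.subst g) = _
  rw [PowerSeries.map_subst hg]
  rfl

/-- `map` of a pair substitution of one-variable series into `F`. [folklore] -/
theorem map_subst_pair_formalGroupLaw_powerSeries {S : Type*} [CommRing S] (φ : R →+* S)
    {g h : R⟦X⟧} (hg : PowerSeries.constantCoeff g = 0) (hh : PowerSeries.constantCoeff h = 0) :
    PowerSeries.map φ (MvPowerSeries.subst ![g, h] W.formalGroupLaw) =
      MvPowerSeries.subst ![PowerSeries.map φ g, PowerSeries.map φ h] (W.map φ).formalGroupLaw :=
  W.map_subst_pair_formalGroupLaw φ (σ := Unit) hg hh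

/-- **`[m + n](t) = F([m](t), [n](t))` for every Weierstrass curve over every commutative ring**
(the maps `[m]` are endomorphisms of `Ê`). [Silverman AEC IV.2.3] [cite: SilvermanAEC2009, IV.2.3] -/
theorem formalMul_add' (m n : ℕ) :
    W.formalMul (m + n) = MvPowerSeries.subst ![W.formalMul m, W.formalMul n] W.formalGroupLaw := by
  have hQ := (universalInt.map (MvPolynomial.map (Int.castRingHom ℚ))).formalMul_add_rat m n
  have hZ : universalInt.formalMul (m + n) =
      MvPowerSeries.subst ![universalInt.formalMul m, universalInt.formalMul n]
        universalInt.formalGroupLaw := by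
    apply mvPowerSeries_map_injective (σ := Unit) mvPolynomial_map_int_rat_injective
    change PowerSeries.map _ _ = PowerSeries.map _ _
    rw [map_formalMul, hQ, map_subst_pair_formalGroupLaw_powerSeries _ _
      (constantCoeff_formalMul _ m) (constantCoeff_formalMul _ n), map_formalMul, map_formalMul]
  have hR := congrArg (PowerSeries.map W.universalEval) hZ
  rwa [map_formalMul, map_subst_pair_formalGroupLaw_powerSeries _ _ (constantCoeff_formalMul _ m)
    (constantCoeff_formalMul _ n), map_formalMul, map_formalMul, universalInt_map] at hR

/-- **`[m]([n](t)) = [mn](t)` for every Weierstrass curve over every commutative ring.**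
[Silverman AEC IV.2.3] [cite: SilvermanAEC2009, IV.2.3] -/
theorem formalMul_mul_subst' (m n : ℕ) :
    (W.formalMul m).subst (W.formalMul n) = W.formalMul (m * n) := by
  have hQ := (universalInt.map (MvPolynomial.map (Int.castRingHom ℚ))).formalMul_mul_subst_rat m n
  have hZ : (universalInt.formalMul m).subst (universalInt.formalMul n) = universalInt.formalMul (m * n) := by
    apply mvPowerSeries_map_injective (σ := Unit) mvPolynomial_map_int_rat_injective
    change PowerSeries.map _ _ = PowerSeries.map _ _
    rw [powerSeries_map_subst _ (hasSubst_formalMul _ n), map_formalMul, map_formalMul, hQ, map_formalMul]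
  have hR := congrArg (PowerSeries.map W.universalEval) hZ
  rwa [powerSeries_map_subst _ (hasSubst_formalMul _ n), map_formalMul, map_formalMul, map_formalMul,
    universalInt_map] at hR

/-- `[m] ∘ [n] = [n] ∘ [m]` over every commutative ring. [Silverman AEC IV.2.3] [folklore] -/
theorem formalMul_subst_comm' (m n : ℕ) :
    (W.formalMul m).subst (W.formalMul n) = (W.formalMul n).subst (W.formalMul m) := by
  rw [formalMul_mul_subst', formalMul_mul_subst', mul_comm]

/-- `[n+1](t) = F(t, [n](t))` over every commutative ring. [Silverman AEC IV.2.1(c)] [folklore] -/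
theorem formalMul_succ'' (n : ℕ) :
    W.formalMul (n + 1) = MvPowerSeries.subst ![(PowerSeries.X : R⟦X⟧), W.formalMul n] W.formalGroupLaw := by
  rw [add_comm, formalMul_add', formalMul_one]

/-- `ω₀([n])·[n]'` commutes with base change. [folklore] -/
theorem map_formalInvDiff_subst_formalMul_mul_derivative {S : Type*} [CommRing S] (φ : R →+* S) (n : ℕ) :
    PowerSeries.map φ (W.formalInvDiff.subst (W.formalMul n) * d⁄dX R (W.formalMul n)) =
      (W.map φ).formalInvDiff.subst ((W.map φ).formalMul n) * d⁄dX S ((W.map φ).formalMul n) := by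
  rw [map_mul, powerSeries_map_subst _ (hasSubst_formalMul _ n), map_formalInvDiff, map_formalMul,
    ← derivative_map, map_formalMul]

/-- **`ω₀([n](t)) · [n]'(t) = n · ω₀(t)` for every Weierstrass curve over every commutative ring**,
`ω₀ = formalInvDiff ∈ R⟦t⟧` the integral invariant differential. [Silverman AEC IV.4.3]
[cite: SilvermanAEC2009, IV.4.3] -/
theorem formalInvDiff_subst_formalMul_mul_derivative' (n : ℕ) :
    W.formalInvDiff.subst (W.formalMul n) * d⁄dX R (W.formalMul n) = n • W.formalInvDiff := by
  have hQ := (universalInt.map (MvPolynomial.map (Int.castRingHom ℚ))).formalInvDiff_subst_formalMul_mul_derivative_rat n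
  have hZ : universalInt.formalInvDiff.subst (universalInt.formalMul n) *
      d⁄dX _ (universalInt.formalMul n) = n • universalInt.formalInvDiff := by
    apply mvPowerSeries_map_injective (σ := Unit) mvPolynomial_map_int_rat_injective
    change PowerSeries.map _ _ = PowerSeries.map _ _
    rw [map_formalInvDiff_subst_formalMul_mul_derivative, hQ, map_nsmul, map_formalInvDiff]
  have hR := congrArg (PowerSeries.map W.universalEval) hZ
  rwa [map_formalInvDiff_subst_formalMul_mul_derivative, map_nsmul, map_formalInvDiff,
    universalInt_map] at hR

/-- **`[n](t) = n·t + O(t²)` over every commutative ring.** [Silverman AEC IV.2.3(a)]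
[cite: SilvermanAEC2009, IV.2.3] -/
theorem coeff_one_formalMul' (n : ℕ) : PowerSeries.coeff 1 (W.formalMul n) = n := by
  have h := congrArg PowerSeries.constantCoeff (W.formalInvDiff_subst_formalMul_mul_derivative' n)
  rw [map_mul, constantCoeff_subst_eq_constantCoeff (W.constantCoeff_formalMul n),
    constantCoeff_formalInvDiff, one_mul, map_nsmul, constantCoeff_formalInvDiff,
    ← PowerSeries.coeff_zero_eq_constantCoeff_apply, PowerSeries.coeff_derivative, zero_add,
    Nat.cast_zero, zero_add, mul_one, nsmul_eq_mul, mul_one] at h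
  exact h

end AnyRingMul


/-! ### The prime `p`: `(p)` in `ℤ[aᵢ]`, and `[p] = p·f + g(tᵖ)` over every ring (AEC IV.4.4) -/

section PrimeIdeal

variable {σ : Type*} (p : ℕ)

/-- The kernel of `ℤ[aᵢ] → 𝔽_p[aᵢ]` is `(p)`. [folklore] -/
theorem ker_mvPolynomial_map_intCast :
    RingHom.ker (MvPolynomial.map (σ := σ) (Int.castRingHom (ZMod p))) =
      Ideal.span {(p : MvPolynomial σ ℤ)} := by
  rw [MvPolynomial.ker_map, ZMod.ker_intCastRingHom, Ideal.map_span, Set.image_singleton, map_natCast]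

/-- **`(p)` is a prime ideal of `ℤ[aᵢ]`.** [folklore] -/
theorem span_natCast_mvPolynomial_isPrime [Fact p.Prime] :
    (Ideal.span {(p : MvPolynomial σ ℤ)}).IsPrime := by
  rw [← ker_mvPolynomial_map_intCast]
  exact RingHom.ker_isPrime _

/-- An integer `k` lies in `(p) ⊆ ℤ[aᵢ]` iff `p ∣ k`. [folklore] -/
theorem natCast_mem_span_natCast_iff (k : ℕ) :
    ((k : ℕ) : MvPolynomial σ ℤ) ∈ Ideal.span {(p : MvPolynomial σ ℤ)} ↔ p ∣ k := by
  constructor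
  · intro h
    obtain ⟨c, hc⟩ := Ideal.mem_span_singleton.mp h
    have h' := congrArg MvPolynomial.constantCoeff hc
    rw [map_natCast, map_mul, map_natCast] at h'
    exact Int.natCast_dvd_natCast.mp ⟨_, h'⟩
  · rintro ⟨c, rfl⟩
    rw [Nat.cast_mul]
    exact Ideal.mul_mem_right _ _ (Ideal.mem_span_singleton_self _)

/-- Membership in `(p)` is tested modulo `p`. [folklore] -/
theorem mem_span_natCast_iff_map_eq_zero (x : MvPolynomial σ ℤ) :
    x ∈ Ideal.span {(p : MvPolynomial σ ℤ)} ↔ MvPolynomial.map (Int.castRingHom (ZMod p)) x = 0 := by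
  rw [← ker_mvPolynomial_map_intCast, RingHom.mem_ker]

end PrimeIdeal

section PrimeMulUniversal

variable (p : ℕ) [Fact p.Prime]

/-- **AEC IV.4.4 universally: `p ∣ [tᵏ][p]` in `ℤ[aᵢ]` for `p ∤ k`.** From
`ω₀([p])·[p]' = p·ω₀`: `[p]' ∈ p·ℤ[aᵢ]⟦t⟧` (`ω₀([p])` is a unit), so `k·cₖ ∈ (p)` with `(p)` prime
and `k ∉ (p)`. [Silverman AEC IV.4.4 (proof via Cor. IV.4.3)] [cite: SilvermanAEC2009, IV.4.4] -/
theorem natCast_dvd_coeff_formalMul_universalInt {k : ℕ} (hk : ¬ p ∣ k) :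
    (p : MvPolynomial (Fin 5) ℤ) ∣ PowerSeries.coeff k (universalInt.formalMul p) := by
  set F := universalInt.formalMul p with hF
  have key := universalInt.formalInvDiff_subst_formalMul_mul_derivative' p
  set u := universalInt.formalInvDiff.subst F with hu
  have hu1 : PowerSeries.constantCoeff u = 1 := by
    rw [hu, constantCoeff_subst_eq_constantCoeff (constantCoeff_formalMul _ p), constantCoeff_formalInvDiff]
  have hunit : IsUnit u := PowerSeries.isUnit_iff_constantCoeff.mpr (by rw [hu1]; exact isUnit_one)
  -- `[p]' = u⁻¹ · p · ω₀`
  have hD : d⁄dX _ F = ↑(hunit.unit⁻¹) * ((p : MvPolynomial (Fin 5) ℤ) • universalInt.formalInvDiff) := by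
    rw [← Nat.cast_smul_eq_nsmul (MvPolynomial (Fin 5) ℤ)] at key
    rw [← key, ← mul_assoc, IsUnit.val_inv_mul, one_mul]
  rcases Nat.eq_zero_or_pos k with rfl | hkpos
  · exact absurd (dvd_zero p) hk
  obtain ⟨j, rfl⟩ := Nat.exists_eq_add_one_of_ne_zero hkpos.ne'
  -- coefficient of `t^j` in `[p]'` is `(j+1)·c_{j+1}`, and lies in `(p)`
  have hcoeff : PowerSeries.coeff (j + 1) F * ((j + 1 : ℕ) : MvPolynomial (Fin 5) ℤ) ∈
      Ideal.span {(p : MvPolynomial (Fin 5) ℤ)} := by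
    have h := congrArg (PowerSeries.coeff j) hD
    rw [PowerSeries.coeff_derivative, smul_eq_C_mul,
      show (↑(hunit.unit⁻¹) : (MvPolynomial (Fin 5) ℤ)⟦X⟧) * (PowerSeries.C (p : MvPolynomial (Fin 5) ℤ) *
          universalInt.formalInvDiff) = PowerSeries.C (p : MvPolynomial (Fin 5) ℤ) *
          (↑(hunit.unit⁻¹) * universalInt.formalInvDiff) by ring, PowerSeries.coeff_C_mul] at h
    rw [Nat.cast_succ, h]
    exact Ideal.mul_mem_right _ _ (Ideal.mem_span_singleton_self _)
  rcases (span_natCast_mvPolynomial_isPrime p).mem_or_mem hcoeff with h | h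
  · exact Ideal.mem_span_singleton.mp h
  · exact absurd ((natCast_mem_span_natCast_iff p (j + 1)).mp h) hk

/-- The `f` of `[p] = p·f + g(tᵖ)` for the universal equation (choice of `cₖ/p` for `p ∤ k`). [cite: SilvermanAEC2009, IV.4.4] -/
def formalMulPPartUniv : (MvPolynomial (Fin 5) ℤ)⟦X⟧ :=
  PowerSeries.mk fun k => if h : p ∣ k then 0
    else (natCast_dvd_coeff_formalMul_universalInt p h).choose

/-- `p · fₖ = [tᵏ][p]` for `p ∤ k` (universal). [folklore] -/
theorem natCast_mul_coeff_formalMulPPartUniv {k : ℕ} (hk : ¬ p ∣ k) :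
    (p : MvPolynomial (Fin 5) ℤ) * PowerSeries.coeff k (formalMulPPartUniv p) =
      PowerSeries.coeff k (universalInt.formalMul p) := by
  rw [formalMulPPartUniv, PowerSeries.coeff_mk, dif_neg hk]
  exact (natCast_dvd_coeff_formalMul_universalInt p hk).choose_spec.symm

end PrimeMulUniversal

section PrimeMul

variable {R : Type*} [CommRing R] (W : WeierstrassCurve R) (p : ℕ)

/-- **`g`** in `[p](t) = p·f(t) + g(tᵖ)`: `g(s) = Σⱼ [t^{pj}][p] · sʲ` (a lift of the Verschiebung:
`[p] ≡ g(tᵖ) (mod p)`), over any ring. [Silverman AEC IV.4.4] [cite: SilvermanAEC2009, IV.4.4] -/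
def formalMulFrobPart : R⟦X⟧ :=
  PowerSeries.mk fun j => PowerSeries.coeff (p * j) (W.formalMul p)

/-- **`f`** in `[p](t) = p·f(t) + g(tᵖ)` over any ring: the specialisation of the universal `f`
(`formalMulPPartUniv`, whose `k`-th coefficient is `[tᵏ][p]/p ∈ ℤ[aᵢ]` for `p ∤ k`, `0` else).
[Silverman AEC IV.4.4] [cite: SilvermanAEC2009, IV.4.4] -/
def formalMulPPart [Fact p.Prime] : R⟦X⟧ :=
  PowerSeries.map W.universalEval (formalMulPPartUniv p)

/-- `g(0) = 0`. [folklore] -/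
@[simp] theorem constantCoeff_formalMulFrobPart : PowerSeries.constantCoeff (W.formalMulFrobPart p) = 0 := by
  rw [← PowerSeries.coeff_zero_eq_constantCoeff_apply, formalMulFrobPart, PowerSeries.coeff_mk,
    mul_zero, PowerSeries.coeff_zero_eq_constantCoeff_apply, constantCoeff_formalMul]

/-- `g'(0) = [tᵖ][p]`. [folklore] -/
theorem coeff_one_formalMulFrobPart :
    PowerSeries.coeff 1 (W.formalMulFrobPart p) = PowerSeries.coeff p (W.formalMul p) := by
  rw [formalMulFrobPart, PowerSeries.coeff_mk, mul_one]

/-- `g` commutes with base change. [folklore] -/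
theorem map_formalMulFrobPart {S : Type*} [CommRing S] (φ : R →+* S) :
    PowerSeries.map φ (W.formalMulFrobPart p) = (W.map φ).formalMulFrobPart p := by
  ext j
  rw [PowerSeries.coeff_map, formalMulFrobPart, formalMulFrobPart, PowerSeries.coeff_mk,
    PowerSeries.coeff_mk, ← PowerSeries.coeff_map, map_formalMul]

/-- `ev_{W.map φ} = φ ∘ ev_W` on `ℤ[aᵢ]`. [folklore] -/
theorem universalEval_map {S : Type*} [CommRing S] (φ : R →+* S) :
    (W.map φ).universalEval = φ.comp W.universalEval := by
  refine MvPolynomial.ringHom_ext (fun n => by simp) fun i => ?_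
  fin_cases i <;> simp [universalEval, WeierstrassCurve.map]

variable [Fact p.Prime]

/-- `f` commutes with base change. [folklore] -/
theorem map_formalMulPPart {S : Type*} [CommRing S] (φ : R →+* S) :
    PowerSeries.map φ (W.formalMulPPart p) = (W.map φ).formalMulPPart p := by
  rw [formalMulPPart, formalMulPPart, universalEval_map, PowerSeries.map_comp]
  rfl

/-- **AEC IV.4.4 over every commutative ring: `[p](t) = p·f(t) + g(tᵖ)`** with
`f = formalMulPPart`, `g = formalMulFrobPart ∈ R⟦t⟧`. [Silverman AEC IV.4.4 ("`[p](T) = pf(T) +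
g(Tᵖ)`")] [cite: SilvermanAEC2009, IV.4.4] -/
theorem formalMul_prime_eq_add_expand :
    W.formalMul p = (p : R⟦X⟧) * W.formalMulPPart p +
      PowerSeries.expand p (Fact.out : p.Prime).ne_zero (W.formalMulFrobPart p) := by
  have hp : p.Prime := Fact.out
  -- universally
  have hZ : universalInt.formalMul p = (p : (MvPolynomial (Fin 5) ℤ)⟦X⟧) * formalMulPPartUniv p +
      PowerSeries.expand p hp.ne_zero (universalInt.formalMulFrobPart p) := by
    ext k
    rw [map_add, ← map_natCast (PowerSeries.C (R := MvPolynomial (Fin 5) ℤ)) p, PowerSeries.coeff_C_mul,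
      PowerSeries.coeff_expand]
    by_cases hk : p ∣ k
    · rw [if_pos hk, formalMulPPartUniv, PowerSeries.coeff_mk, dif_pos hk, mul_zero, zero_add,
        formalMulFrobPart, PowerSeries.coeff_mk, Nat.mul_div_cancel' hk]
    · rw [if_neg hk, add_zero, natCast_mul_coeff_formalMulPPartUniv p hk]
  -- specialise
  have hR := congrArg (PowerSeries.map W.universalEval) hZ
  rw [map_formalMul, universalInt_map, map_add, map_mul, map_natCast, PowerSeries.map_expand,
    map_formalMulFrobPart, universalInt_map] at hR
  exact hR

/-- **`[p](t) ≡ g(tᵖ) (mod p)`**, coefficientwise: `[tᵏ][p] ∈ (p)` for `p ∤ k`, over any ring.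
[Silverman AEC IV.4.4] [cite: SilvermanAEC2009, IV.4.4] -/
theorem coeff_formalMul_prime_mem_span {k : ℕ} (hk : ¬ p ∣ k) :
    PowerSeries.coeff k (W.formalMul p) ∈ Ideal.span {(p : R)} := by
  have hp : p.Prime := Fact.out
  rw [W.formalMul_prime_eq_add_expand p, map_add, PowerSeries.coeff_expand, if_neg hk, add_zero,
    ← map_natCast (PowerSeries.C (R := R)) p, PowerSeries.coeff_C_mul]
  exact Ideal.mul_mem_right _ _ (Ideal.mem_span_singleton_self _)

end PrimeMul

/-! ### `[tᵖ][p] ≡ w_{p-1} ≡` Hasse invariant `(mod p)` over every ring (Katz–Mazur 12.4.2) -/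

section Verschiebung

variable {R : Type*} [CommRing R]

/-- `(g(tᵖ))' = p·t^{p-1}·g'(tᵖ)`. [folklore] -/
theorem derivative_expand (p : ℕ) (hp : p ≠ 0) (g : R⟦X⟧) :
    d⁄dX R (PowerSeries.expand p hp g) =
      (p : R⟦X⟧) * PowerSeries.X ^ (p - 1) * PowerSeries.expand p hp (d⁄dX R g) := by
  ext n
  rw [PowerSeries.coeff_derivative, PowerSeries.coeff_expand, ← map_natCast (PowerSeries.C (R := R)) p,
    mul_assoc, PowerSeries.coeff_C_mul]
  by_cases hn : p - 1 ≤ n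
  · rw [PowerSeries.coeff_X_pow_mul', if_pos hn, PowerSeries.coeff_expand]
    have e : n + 1 = (n - (p - 1)) + p := by omega
    by_cases hd : p ∣ n + 1
    · have hd' : p ∣ n - (p - 1) := by
        rw [e] at hd; exact (Nat.dvd_add_left (dvd_refl p)).mp hd
      rw [if_pos hd, if_pos hd', PowerSeries.coeff_derivative]
      obtain ⟨q, hq⟩ := hd'
      have hq' : (n + 1) / p = q + 1 := by
        rw [e, hq, ← Nat.mul_succ, Nat.mul_div_cancel_left _ (Nat.pos_of_ne_zero hp)]
      rw [hq', hq, Nat.mul_div_cancel_left _ (Nat.pos_of_ne_zero hp)]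
      have hcast : ((n + 1 : ℕ) : R) = (p : R) * ((q + 1 : ℕ) : R) := by
        rw [← Nat.cast_mul]; congr 1; rw [e, hq]; ring
      rw [show ((n : R) + 1) = ((n + 1 : ℕ) : R) by push_cast; ring, hcast]
      push_cast; ring
    · have hd' : ¬ p ∣ n - (p - 1) := fun h => hd (by
        rw [e]; exact (Nat.dvd_add_left (dvd_refl p)).mpr h)
      rw [if_neg hd, if_neg hd', zero_mul, mul_zero]
  · rw [PowerSeries.coeff_X_pow_mul', if_neg hn, mul_zero]
    have hd : ¬ p ∣ n + 1 := fun h => hn (by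
      have := Nat.le_of_dvd (Nat.succ_pos n) h; omega)
    rw [if_neg hd, zero_mul]

/-- `ω(g(tᵖ)) = (ω ∘ g)(tᵖ)`: substituting a series in `tᵖ` gives a series in `tᵖ`. [folklore] -/
theorem subst_expand_eq_expand_subst (p : ℕ) (hp : p ≠ 0) (f : R⟦X⟧) {g : R⟦X⟧}
    (hg : PowerSeries.constantCoeff g = 0) :
    f.subst (PowerSeries.expand p hp g) = PowerSeries.expand p hp (f.subst g) := by
  rw [PowerSeries.expand_apply, PowerSeries.expand_apply,
    PowerSeries.subst_comp_subst_apply (PowerSeries.HasSubst.of_constantCoeff_zero' hg)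
      (PowerSeries.HasSubst.X_pow hp)]

/-- `universalInt.universalEval = id`. [folklore] -/
theorem universalEval_universalInt :
    (universalInt.universalEval : MvPolynomial (Fin 5) ℤ →+* MvPolynomial (Fin 5) ℤ) = RingHom.id _ := by
  refine MvPolynomial.ringHom_ext (fun n => by simp) fun i => ?_
  fin_cases i <;> simp [universalEval, universalInt]

/-- `p ≠ 0` in `ℤ[aᵢ]⟦t⟧`. [folklore] -/
theorem natCast_powerSeries_universal_ne_zero {p : ℕ} (hp : p ≠ 0) :
    (p : (MvPolynomial (Fin 5) ℤ)⟦X⟧) ≠ 0 := by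
  rw [← map_natCast (PowerSeries.C (R := MvPolynomial (Fin 5) ℤ)) p, Ne,
    ← map_zero (PowerSeries.C (R := MvPolynomial (Fin 5) ℤ)), PowerSeries.C_injective.eq_iff,
    Nat.cast_eq_zero]
  exact hp

variable (p : ℕ) [Fact p.Prime]

/-- In characteristic `p`, `[p](t) = g(tᵖ)` exactly. [Silverman AEC IV.4.4] [folklore] -/
theorem formalMul_prime_eq_expand_of_charP {S : Type*} [CommRing S] [CharP S p] (V : WeierstrassCurve S) :
    V.formalMul p = PowerSeries.expand p (Fact.out : p.Prime).ne_zero (V.formalMulFrobPart p) := by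
  rw [V.formalMul_prime_eq_add_expand p, ← map_natCast (PowerSeries.C (R := S)) p, CharP.cast_eq_zero,
    map_zero, zero_mul, zero_add]

/-- **Katz–Mazur 12.4.2 universally: `[tᵖ][p] ≡ w_{p-1} (mod p)` in `ℤ[aᵢ]`** (`ω₀ = Σ wₙ tⁿ dt`).
Proof: `ω₀([p])·[p]' = p·ω₀` with `[p] = p f + g(tᵖ)` gives, after cancelling `p`,
`ω₀([p])·(f' + t^{p-1}g'(tᵖ)) = ω₀`; modulo `p`, `ω₀([p]) ≡ (ω₀∘g)(tᵖ) ∈ 1 + tᵖ𝔽_p[aᵢ]⟦tᵖ⟧`, and the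
coefficient of `t^{p-1}` reads `g'(0) = [tᵖ][p] ≡ w_{p-1}`. [Katz–Mazur 1985, 12.4.2; Silverman AEC
IV.4.4, IV.7.2] [cite: SilvermanAEC2009, IV.4.4] -/
theorem coeff_prime_formalMul_sub_coeff_formalInvDiff_mem_universalInt :
    PowerSeries.coeff p (universalInt.formalMul p) - PowerSeries.coeff (p - 1) universalInt.formalInvDiff ∈
      Ideal.span {(p : MvPolynomial (Fin 5) ℤ)} := by
  have hp : p.Prime := Fact.out
  have hp0 : p ≠ 0 := hp.ne_zero
  set 𝓡 := MvPolynomial (Fin 5) ℤ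
  set U : WeierstrassCurve 𝓡 := universalInt with hU
  set F := U.formalMul p with hF
  set ω₀ := U.formalInvDiff with hω
  set f : 𝓡⟦X⟧ := formalMulPPartUniv p with hf
  set g := U.formalMulFrobPart p with hg
  set u := ω₀.subst F with hu
  set E := d⁄dX 𝓡 f + PowerSeries.X ^ (p - 1) * PowerSeries.expand p hp0 (d⁄dX 𝓡 g) with hE
  -- `[p] = p f + g(tᵖ)` universally
  have hdec : F = (p : 𝓡⟦X⟧) * f + PowerSeries.expand p hp0 g := by
    have h := U.formalMul_prime_eq_add_expand p
    rw [formalMulPPart, hU, universalEval_universalInt, PowerSeries.map_id] at h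
    exact h
  -- `[p]' = p • E`
  have hD : d⁄dX 𝓡 F = (p : 𝓡⟦X⟧) * E := by
    rw [hdec, map_add, derivative_expand, hE]
    have h1 : d⁄dX 𝓡 ((p : 𝓡⟦X⟧) * f) = (p : 𝓡⟦X⟧) * d⁄dX 𝓡 f := by
      rw [← nsmul_eq_mul, map_nsmul, nsmul_eq_mul]
    rw [h1]; ring
  -- cancel `p`: `u * E = ω₀`
  have key : u * E = ω₀ := by
    have h := U.formalInvDiff_subst_formalMul_mul_derivative' p
    rw [← hF, ← hω, ← hu, hD, nsmul_eq_mul] at h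
    have h' : (p : 𝓡⟦X⟧) * (u * E - ω₀) = 0 := by rw [mul_sub, ← h]; ring
    exact sub_eq_zero.mp ((mul_eq_zero.mp h').resolve_left (natCast_powerSeries_universal_ne_zero hp0))
  -- reduce modulo `p`
  set π : 𝓡 →+* MvPolynomial (Fin 5) (ZMod p) := MvPolynomial.map (Int.castRingHom (ZMod p)) with hπ
  have hg0 : PowerSeries.constantCoeff g = 0 := U.constantCoeff_formalMulFrobPart p
  have hgπ0 : PowerSeries.constantCoeff ((U.map π).formalMulFrobPart p) = 0 :=
    (U.map π).constantCoeff_formalMulFrobPart p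
  -- `π u = (ω₀' ∘ g')(tᵖ)`
  have hπu : PowerSeries.map π u = PowerSeries.expand p hp0
      ((U.map π).formalInvDiff.subst ((U.map π).formalMulFrobPart p)) := by
    rw [hu, hF, hω, powerSeries_map_subst _ (U.hasSubst_formalMul p), map_formalInvDiff, map_formalMul,
      formalMul_prime_eq_expand_of_charP p (U.map π), subst_expand_eq_expand_subst p hp0 _ hgπ0]
  -- coefficients of `π u`
  have hπu0 : PowerSeries.coeff 0 (PowerSeries.map π u) = 1 := by
    rw [hπu, PowerSeries.coeff_expand, if_pos (dvd_zero p), Nat.zero_div,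
      PowerSeries.coeff_zero_eq_constantCoeff_apply, constantCoeff_subst_eq_constantCoeff hgπ0,
      constantCoeff_formalInvDiff]
  have hπuk : ∀ {k : ℕ}, ¬ p ∣ k → PowerSeries.coeff k (PowerSeries.map π u) = 0 := fun hk => by
    rw [hπu, PowerSeries.coeff_expand, if_neg hk]
  -- the coefficient of `t^{p-1}` in `π E` is `π ([tᵖ][p])`
  have hπE : PowerSeries.coeff (p - 1) (PowerSeries.map π E) = π (PowerSeries.coeff p F) := by
    rw [hE, map_add, map_mul, ← derivative_map, map_pow, PowerSeries.map_X, PowerSeries.map_expand,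
      ← derivative_map, map_add, PowerSeries.coeff_derivative, Nat.sub_add_cancel hp.one_lt.le,
      PowerSeries.coeff_X_pow_mul', if_pos le_rfl, Nat.sub_self, PowerSeries.coeff_expand,
      if_pos (dvd_zero p), Nat.zero_div, PowerSeries.coeff_derivative, zero_add, Nat.cast_zero,
      zero_add, mul_one, map_formalMulFrobPart, coeff_one_formalMulFrobPart, ← map_formalMul]
    have hpz : ((p - 1 : ℕ) : MvPolynomial (Fin 5) (ZMod p)) + 1 = 0 := by
      rw [← Nat.cast_succ, show (p - 1).succ = p from Nat.succ_pred_eq_of_pos hp.pos, CharP.cast_eq_zero]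
    rw [hpz, mul_zero, zero_add, PowerSeries.coeff_map, hF]
  -- compare coefficients of `t^{p-1}` in `π(u E) = π ω₀`
  have hcmp : π (PowerSeries.coeff p F) = π (PowerSeries.coeff (p - 1) ω₀) := by
    have h := congrArg (fun s => PowerSeries.coeff (p - 1) (PowerSeries.map π s)) key
    rw [map_mul, PowerSeries.coeff_mul, Finset.sum_eq_single (0, p - 1), hπu0, one_mul, hπE,
      PowerSeries.coeff_map] at h
    · exact h
    · rintro ⟨i, j⟩ hij hne
      have hij' : i + j = p - 1 := Finset.mem_antidiagonal.mp hij
      have hi0 : i ≠ 0 := fun hi => hne (by subst hi; simp_all)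
      have hi : ¬ p ∣ i := fun hd => by
        have := Nat.le_of_dvd (Nat.pos_of_ne_zero hi0) hd; omega
      rw [hπuk hi, zero_mul]
    · intro h0
      exact absurd (Finset.mem_antidiagonal.mpr (by omega)) h0
  rw [mem_span_natCast_iff_map_eq_zero, map_sub, sub_eq_zero]
  exact hcmp

variable (W : WeierstrassCurve R)

/-- **`[tᵖ][p] ≡ w_{p-1} (mod p)` for every Weierstrass curve over every commutative ring**
(`ω₀ = formalInvDiff = Σ wₙ tⁿ`; specialise the universal congruence). [Katz–Mazur 1985, 12.4.2;
Silverman AEC IV.4.4] [cite: SilvermanAEC2009, IV.4.4] -/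
theorem coeff_prime_formalMul_sub_coeff_formalInvDiff_mem_span :
    PowerSeries.coeff p (W.formalMul p) - PowerSeries.coeff (p - 1) W.formalInvDiff ∈
      Ideal.span {(p : R)} := by
  obtain ⟨c, hc⟩ := Ideal.mem_span_singleton.mp
    (coeff_prime_formalMul_sub_coeff_formalInvDiff_mem_universalInt p)
  have h := congrArg W.universalEval hc
  rw [map_sub, ← PowerSeries.coeff_map, ← PowerSeries.coeff_map, map_formalMul, map_formalInvDiff,
    universalInt_map, map_mul, map_natCast] at h
  exact Ideal.mem_span_singleton.mpr ⟨_, h⟩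

/-- **`[tᵖ][p] ≡ A_p (mod p)` for every Weierstrass curve over every commutative ring** (`p` odd;
`A_p = hasseCoeff`, Deuring's coefficient of `x^{p-1}` in `Ψ₂²(x)^{(p-1)/2}`): modulo `p`,
`[p](t) = V(tᵖ)` with `V(s) = A_p·s + O(s²)` — the Verschiebung's linear term is the Hasse
invariant. (`coeff_prime_formalMul_sub_coeff_formalInvDiff_mem_span` and the tree's
characteristic-`p` identity `w_{p-1} = A_p`, `coeff_formalInvDiff_prime_sub_one`.)
[Katz–Mazur 1985, 12.4.2; Silverman AEC IV.4.4, V.4.1] [cite: SilvermanAEC2009, IV.4.4] -/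
theorem coeff_prime_formalMul_sub_hasseCoeff_mem_span (hp2 : p ≠ 2) :
    PowerSeries.coeff p (W.formalMul p) - W.hasseCoeff p ∈ Ideal.span {(p : R)} := by
  have hp : p.Prime := Fact.out
  obtain ⟨m, hpm⟩ : ∃ m, p = 2 * m + 1 := hp.eq_two_or_odd'.resolve_left hp2
  -- universally: `w_{p-1} ≡ A_p (mod p)` in `ℤ[aᵢ]`
  have huniv : PowerSeries.coeff (p - 1) universalInt.formalInvDiff - universalInt.hasseCoeff p ∈
      Ideal.span {(p : MvPolynomial (Fin 5) ℤ)} := by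
    rw [mem_span_natCast_iff_map_eq_zero, map_sub, sub_eq_zero, ← PowerSeries.coeff_map,
      map_formalInvDiff, coeff_formalInvDiff_prime_sub_one _ p hpm, map_hasseCoeff]
  have h1 := coeff_prime_formalMul_sub_coeff_formalInvDiff_mem_span p W
  obtain ⟨c, hc⟩ := Ideal.mem_span_singleton.mp huniv
  have h := congrArg W.universalEval hc
  rw [map_sub, ← PowerSeries.coeff_map, map_formalInvDiff, ← map_hasseCoeff, universalInt_map,
    map_mul, map_natCast] at h
  have h2 : PowerSeries.coeff (p - 1) W.formalInvDiff - W.hasseCoeff p ∈ Ideal.span {(p : R)} :=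
    Ideal.mem_span_singleton.mpr ⟨_, h⟩
  have e : PowerSeries.coeff p (W.formalMul p) - W.hasseCoeff p =
      (PowerSeries.coeff p (W.formalMul p) - PowerSeries.coeff (p - 1) W.formalInvDiff) +
        (PowerSeries.coeff (p - 1) W.formalInvDiff - W.hasseCoeff p) := by ring
  rw [e]
  exact add_mem h1 h2

/-- The same for `g'(0)` of `[p] = p f + g(tᵖ)`: **`g(s) ≡ A_p·s (mod (p, s²))`.**
[cite: SilvermanAEC2009, IV.4.4] -/
theorem coeff_one_formalMulFrobPart_sub_hasseCoeff_mem_span (hp2 : p ≠ 2) :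
    PowerSeries.coeff 1 (W.formalMulFrobPart p) - W.hasseCoeff p ∈ Ideal.span {(p : R)} := by
  rw [coeff_one_formalMulFrobPart]
  exact W.coeff_prime_formalMul_sub_hasseCoeff_mem_span p hp2

end Verschiebung

end WeierstrassCurve
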